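import Summits.AtomisticToContinuum.HydrodynamicLimit.Theorems.ImplosionDichotomyTypeOneGlue

/-!
# Glueing the exact implosion into the exterior periodic solution: the glued fields solve Euler

Helper file for the support item `TypeOneIdealImplosion` (stmt-AtomisticToContinuum-15146) of the
route `ImplosionDichotomy` (`AtomisticToContinuum/HydrodynamicLimit`), companion of
`…TypeOneGlue` (the glued fields `ρ₁ = ρ_τ + transplant(ψ(ρ_E − lift ρ_τ))`, `u₁` likewise, and
their local structure). Here: if `E = (ρ_E, u_E)` is a smooth solution of the isentropic Euler
equations (`γ = 5/3`) on `[0, T) × ℝ³` in Euclidean calculus (the shape delivered by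
`Literature.Analysis.FluidPDE.CaolaboraEtAl2025.exactSolution_of_profile`), `τ = (ρ_τ, u_τ)` is a
classical isentropic solution on `[0, T) × 𝕋³`
(`Literature.Analysis.FluidPDE.IsIsentropicEulerSolution (5/3)`), and the two agree on the annulus
`1/16 ≤ |w| ≤ 1/8` of the fundamental cell for all `t ∈ [0, T)`, then the glued fields form a
classical isentropic solution on `[0, T) × 𝕋³` (`isIsentropicEulerSolution_glue`). The equations
are local: near a core point the glued fields ARE `E` (read through the covering map, for all
times at once), near an exterior point they ARE `τ`; the torus calculus is converted to Euclidean
calculus of lifts by `Torus.partialDeriv_proj_eq`, `IsentropicEuler.gradient_proj_eq` and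
`derivWithin` congruences. Folklore bookkeeping (Cao-Labora–Gómez-Serrano–Shi–Staffilani, Rem. 1.5:
"the periodic result can be easily deduced from the non-periodic one").
-/

noncomputable section

namespace Summit.AtomisticToContinuum.HydrodynamicLimit.Theorems

open Set Filter Topology Metric Function
open scoped ContDiff
open Literature.MathematicalPhysics.KineticTheory
open Literature.Analysis.FunctionSpaces Literature.Analysis.FunctionSpaces.Torus
open Literature.Analysis.FluidPDE (IsIsentropicEulerSolution)
open Literature.Analysis.FluidPDE.IsentropicEuler (partialDeriv_proj_eq gradient_proj_eq)

/-! ## Converting torus calculus to Euclidean calculus along local identities -/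

section Convert

variable {F : Type*} [NormedAddCommGroup F] [NormedSpace ℝ F]

/-- One-sided time derivatives of two fields whose time slices at `x` agree on `S` coincide.
[folklore] -/
theorem timeDerivWithin_congr_slice {S : Set ℝ} {f g : ℝ → T3 → F} {x : T3}
    (h : ∀ t ∈ S, f t x = g t x) {t : ℝ} (ht : t ∈ S) :
    timeDerivWithin S f t x = timeDerivWithin S g t x :=
  derivWithin_congr (fun s hs => h s hs) (h t ht)

/-- If the time slice of `f` at `x` agrees on `[0, T)` with a function `G` differentiable at
`t ∈ [0, T)`, then `∂ₜf(t, x) = G'(t)` (one-sided within `[0, T)`). [folklore] -/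
theorem timeDerivWithin_eq_deriv_of_eq {T : ℝ} {f : ℝ → T3 → F} {x : T3} {G : ℝ → F}
    (h : ∀ t ∈ Ico 0 T, f t x = G t) {t : ℝ} (ht : t ∈ Ico 0 T) (hG : DifferentiableAt ℝ G t) :
    timeDerivWithin (Ico 0 T) f t x = deriv G t := by
  rw [show timeDerivWithin (Ico 0 T) f t x = derivWithin G (Ico 0 T) t from
    derivWithin_congr (fun s hs => h s hs) (h t ht)]
  exact hG.derivWithin (uniqueDiffOn_Ico 0 T t ht)

/-- Partial derivatives on the torus through a local Euclidean model of the lift: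
`∂ᵢf(proj y₀) = DG(y₀)eᵢ` if `lift f = G` near `y₀` (`f` of class `C¹`). [folklore] -/
theorem partialDeriv_eq_of_eventuallyEq {f : T3 → F} (hf : IsContDiff 1 f) {G : V3 → F} {y₀ : V3}
    (h : lift f =ᶠ[𝓝 y₀] G) (i : Fin 3) :
    partialDeriv i f (proj y₀) = fderiv ℝ G y₀ (EuclideanSpace.single i 1) := by
  rw [partialDeriv_proj_eq hf, h.fderiv_eq]

/-- Gradients on the torus through a local Euclidean model of the lift. [folklore] -/
theorem gradient_eq_of_eventuallyEq {θ : T3 → ℝ} {G : V3 → ℝ} {y₀ : V3} (h : lift θ =ᶠ[𝓝 y₀] G) :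
    Torus.gradient θ (proj y₀) = gradient G y₀ := by
  rw [gradient_proj_eq, h.gradient_eq]

/-- Slices of a function smooth on the open half-space `{t < T} × ℝ³` are differentiable in time.
[folklore] -/
theorem differentiableAt_slice_of_contDiffOn {T : ℝ} {f : ℝ → V3 → F}
    (hf : ContDiffOn ℝ ∞ (fun p : ℝ × V3 => f p.1 p.2) {p | p.1 < T}) {t : ℝ} (ht : t < T) (y : V3) :
    DifferentiableAt ℝ (fun τ => f τ y) t := by
  have hopen : IsOpen {p : ℝ × V3 | p.1 < T} := isOpen_lt continuous_fst continuous_const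
  have h1 : DifferentiableAt ℝ (fun p : ℝ × V3 => f p.1 p.2) (t, y) :=
    (hf.differentiableOn (by simp)).differentiableAt (hopen.mem_nhds ht)
  have h2 : DifferentiableAt ℝ (fun τ : ℝ => (τ, y)) t :=
    differentiableAt_id.prodMk (differentiableAt_const _)
  exact h1.comp t h2

/-- Slices of a function smooth on `{t < T} × ℝ³` are smooth in space. [folklore] -/
theorem contDiff_slice_of_contDiffOn {T : ℝ} {f : ℝ → V3 → F}
    (hf : ContDiffOn ℝ ∞ (fun p : ℝ × V3 => f p.1 p.2) {p | p.1 < T}) {t : ℝ} (ht : t < T) :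
    ContDiff ℝ ∞ (f t) :=
  hf.comp_contDiff (contDiff_const.prodMk contDiff_id) fun _ => ht

end Convert

/-! ## The glued solution -/

section Solution

variable {T : ℝ} {ψ : V3 → ℝ} {ρE : ℝ → V3 → ℝ} {uE : ℝ → V3 → V3} {ρτ : ℝ → T3 → ℝ}
  {uτ : ℝ → T3 → V3}

/-- **Core points of the glued field.** At a point `x ∈ 𝕋³` whose centred representative
`y₀ = reprc x` has `|y₀| < 1/8`, the lift of the glued field agrees with `f_E(t)` near `y₀` for
every `t ∈ S`, and in particular the glued field equals `f_E(t, y₀)` at `x` for all `t ∈ S`.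
[folklore] -/
theorem glue_core_nhds {F : Type*} [NormedAddCommGroup F] [NormedSpace ℝ F] {S : Set ℝ}
    {fE : ℝ → V3 → F} {fτ : ℝ → T3 → F}
    (hψ1 : ∀ w, ‖w‖ ≤ 3 / 32 → ψ w = 1) (hψ0 : ∀ w, 1 / 8 ≤ ‖w‖ → ψ w = 0)
    (hagree : ∀ t ∈ S, ∀ w : V3, 1 / 16 ≤ ‖w‖ → ‖w‖ ≤ 1 / 8 → fτ t (proj w) = fE t w)
    (x : T3) (hx : ‖reprc x‖ < 1 / 8) {t : ℝ} (ht : t ∈ S) :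
    (lift (fun z => fτ t z + transplant (fun w => ψ w • (fE t w - fτ t (proj w))) z) =ᶠ[𝓝 (reprc x)]
        fE t) ∧
      fτ t x + transplant (fun w => ψ w • (fE t w - fτ t (proj w))) x = fE t (reprc x) := by
  set y₀ := reprc x with hy₀
  have hy₀' : ‖reprc (proj y₀)‖ < 1 / 8 := by rwa [hy₀, proj_reprc]
  have hε : 0 < 1 / 8 - ‖reprc (proj y₀)‖ := by linarith [hy₀']
  have hshift : y₀ - reprc (proj y₀) = 0 := by rw [hy₀, proj_reprc, sub_self]
  have key : ∀ y, dist y y₀ < 1 / 8 - ‖reprc (proj y₀)‖ →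
      fτ t (proj y) + transplant (fun w => ψ w • (fE t w - fτ t (proj w))) (proj y) = fE t y := by
    intro y hy
    have h := glue_local_core (fE := fE) (fτ := fτ) (ψ := ψ) hψ1 hψ0 hagree y₀ hy ht
    rw [hshift, sub_zero] at h
    exact h
  refine ⟨?_, ?_⟩
  · filter_upwards [ball_mem_nhds y₀ hε] with y hy using key y hy
  · have h := key y₀ (by rw [dist_self]; exact hε)
    rwa [hy₀, proj_reprc] at h

/-- **Exterior points of the glued field.** At a point `x ∈ 𝕋³` with `|reprc x| ≥ 1/8`, the lift
of the glued field agrees with the lift of `f_τ(t)` near `reprc x` for every `t ∈ S`, and the glued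
field equals `f_τ(t, x)` at `x`. [folklore] -/
theorem glue_exterior_nhds {F : Type*} [NormedAddCommGroup F] [NormedSpace ℝ F] {S : Set ℝ}
    {fE : ℝ → V3 → F} {fτ : ℝ → T3 → F}
    (hψ0 : ∀ w, 1 / 8 ≤ ‖w‖ → ψ w = 0)
    (hagree : ∀ t ∈ S, ∀ w : V3, 1 / 16 ≤ ‖w‖ → ‖w‖ ≤ 1 / 8 → fτ t (proj w) = fE t w)
    (x : T3) (hx : 1 / 8 ≤ ‖reprc x‖) {t : ℝ} (ht : t ∈ S) :
    (lift (fun z => fτ t z + transplant (fun w => ψ w • (fE t w - fτ t (proj w))) z) =ᶠ[𝓝 (reprc x)]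
        lift (fτ t)) ∧
      fτ t x + transplant (fun w => ψ w • (fE t w - fτ t (proj w))) x = fτ t x := by
  set y₀ := reprc x with hy₀
  have hy₀' : 3 / 32 < ‖reprc (proj y₀)‖ := by rw [hy₀, proj_reprc]; linarith
  have hε : 0 < min (‖reprc (proj y₀)‖ - 3 / 32) (1 / 4) := lt_min (by linarith [hy₀']) (by norm_num)
  have key : ∀ y, dist y y₀ < min (‖reprc (proj y₀)‖ - 3 / 32) (1 / 4) →
      fτ t (proj y) + transplant (fun w => ψ w • (fE t w - fτ t (proj w))) (proj y) = fτ t (proj y) :=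
    fun y hy => glue_local_exterior (fE := fE) (fτ := fτ) (ψ := ψ) hψ0 hagree y₀
      (lt_of_lt_of_le hy (min_le_left _ _)) (lt_of_lt_of_le hy (min_le_right _ _)) ht
  refine ⟨?_, ?_⟩
  · filter_upwards [ball_mem_nhds y₀ hε] with y hy using key y hy
  · have h := key y₀ (by rw [dist_self]; exact hε)
    rwa [hy₀, proj_reprc] at h

/-- **The glued fields form a classical isentropic solution on `[0, T) × 𝕋³`.** See the module
docstring. [cite: CaolaboraEtAl2025, Rem. 1.5 p. 7] -/
theorem isIsentropicEulerSolution_glue (hψ : ContDiff ℝ ∞ ψ)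
    (hψ1 : ∀ w, ‖w‖ ≤ 3 / 32 → ψ w = 1) (hψ0 : ∀ w, 1 / 8 ≤ ‖w‖ → ψ w = 0)
    (hEρ : ContDiffOn ℝ ∞ (fun p : ℝ × V3 => ρE p.1 p.2) {p | p.1 < T})
    (hEu : ContDiffOn ℝ ∞ (fun p : ℝ × V3 => uE p.1 p.2) {p | p.1 < T})
    (hEpos : ∀ t < T, ∀ x, 0 < ρE t x)
    (hEmass : ∀ t < T, ∀ x, deriv (fun τ => ρE τ x) t +
      ∑ i, fderiv ℝ (fun z => ρE t z * uE t z i) x (EuclideanSpace.single i 1) = 0)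
    (hEmom : ∀ t < T, ∀ x, ρE t x • deriv (fun τ => uE τ x) t +
        ρE t x • ∑ i, uE t x i • fderiv ℝ (uE t) x (EuclideanSpace.single i 1) +
      gradient (fun z => ρE t z ^ (5 / 3 : ℝ) / (5 / 3)) x = 0)
    (hτ : IsIsentropicEulerSolution (5 / 3) T ρτ uτ)
    (hagρ : ∀ t ∈ Ico 0 T, ∀ w : V3, 1 / 16 ≤ ‖w‖ → ‖w‖ ≤ 1 / 8 → ρτ t (proj w) = ρE t w)
    (hagu : ∀ t ∈ Ico 0 T, ∀ w : V3, 1 / 16 ≤ ‖w‖ → ‖w‖ ≤ 1 / 8 → uτ t (proj w) = uE t w) :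
    IsIsentropicEulerSolution (5 / 3) T
      (fun t x => ρτ t x + transplant (fun w => ψ w • (ρE t w - ρτ t (proj w))) x)
      (fun t x => uτ t x + transplant (fun w => ψ w • (uE t w - uτ t (proj w))) x) := by
  -- notation
  set ρ₁ : ℝ → T3 → ℝ := fun t x => ρτ t x + transplant (fun w => ψ w • (ρE t w - ρτ t (proj w))) x
    with hρ₁
  set u₁ : ℝ → T3 → V3 := fun t x => uτ t x + transplant (fun w => ψ w • (uE t w - uτ t (proj w))) x
    with hu₁
  have hsub : Ico 0 T ×ˢ (univ : Set V3) ⊆ {p : ℝ × V3 | p.1 < T} := fun p hp => (mem_prod.1 hp).1.2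
  have hρ₁s : IsSmoothSpaceTimeOn (Ico 0 T) ρ₁ :=
    isSmoothSpaceTimeOn_glue hψ hψ0 hτ.smooth_density (hEρ.mono hsub)
  have hu₁s : IsSmoothSpaceTimeOn (Ico 0 T) u₁ :=
    isSmoothSpaceTimeOn_glue hψ hψ0 hτ.smooth_velocity (hEu.mono hsub)
  -- local structure at a point `x`, read at `y₀ = reprc x`
  have hcore : ∀ x : T3, ‖reprc x‖ < 1 / 8 → ∀ t ∈ Ico 0 T,
      (lift (ρ₁ t) =ᶠ[𝓝 (reprc x)] ρE t) ∧ (lift (u₁ t) =ᶠ[𝓝 (reprc x)] uE t) ∧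
        (∀ t' ∈ Ico 0 T, ρ₁ t' x = ρE t' (reprc x) ∧ u₁ t' x = uE t' (reprc x)) :=
    fun x hx t ht =>
      ⟨(glue_core_nhds hψ1 hψ0 hagρ x hx ht).1, (glue_core_nhds hψ1 hψ0 hagu x hx ht).1,
        fun t' ht' => ⟨(glue_core_nhds hψ1 hψ0 hagρ x hx ht').2, (glue_core_nhds hψ1 hψ0 hagu x hx ht').2⟩⟩
  have hext : ∀ x : T3, 1 / 8 ≤ ‖reprc x‖ → ∀ t ∈ Ico 0 T,
      (lift (ρ₁ t) =ᶠ[𝓝 (reprc x)] lift (ρτ t)) ∧ (lift (u₁ t) =ᶠ[𝓝 (reprc x)] lift (uτ t)) ∧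
        (∀ t' ∈ Ico 0 T, ρ₁ t' x = ρτ t' x ∧ u₁ t' x = uτ t' x) :=
    fun x hx t ht =>
      ⟨(glue_exterior_nhds hψ0 hagρ x hx ht).1, (glue_exterior_nhds hψ0 hagu x hx ht).1,
        fun t' ht' => ⟨(glue_exterior_nhds hψ0 hagρ x hx ht').2, (glue_exterior_nhds hψ0 hagu x hx ht').2⟩⟩
  -- smoothness of slices
  have hρ₁1 : ∀ t ∈ Ico 0 T, IsContDiff 1 (ρ₁ t) := fun t ht => (hρ₁s.isSmooth_slice ht).of_le (mod_cast le_top)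
  have hu₁1 : ∀ t ∈ Ico 0 T, IsContDiff 1 (u₁ t) := fun t ht => (hu₁s.isSmooth_slice ht).of_le (mod_cast le_top)
  have hτρ1 : ∀ t ∈ Ico 0 T, IsContDiff 1 (ρτ t) := fun t ht =>
    (hτ.smooth_density.isSmooth_slice ht).of_le (mod_cast le_top)
  have hτu1 : ∀ t ∈ Ico 0 T, IsContDiff 1 (uτ t) := fun t ht =>
    (hτ.smooth_velocity.isSmooth_slice ht).of_le (mod_cast le_top)
  refine ⟨hρ₁s, hu₁s, fun t ht x => ?_, fun t ht x => ?_, fun t ht x => ?_⟩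
  · -- positivity
    by_cases hx : ‖reprc x‖ < 1 / 8
    · rw [((hcore x hx t ht).2.2 t ht).1]; exact hEpos t ht.2 _
    · rw [((hext x (not_lt.1 hx) t ht).2.2 t ht).1]; exact hτ.density_pos t ht x
  · -- mass
    have hP : IsSmooth (fun y => ρ₁ t y • u₁ t y) := by
      change ContDiff ℝ ∞ fun z => ρ₁ t (proj z) • u₁ t (proj z)
      exact ContDiff.smul (hρ₁s.isSmooth_slice ht) (hu₁s.isSmooth_slice ht)
    have hPi : ∀ i : Fin 3, IsContDiff 1 (fun y => (ρ₁ t y • u₁ t y) i) := fun i =>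
      (hP.apply i).of_le (mod_cast le_top)
    have hPτ : IsSmooth (fun y => ρτ t y • uτ t y) := by
      change ContDiff ℝ ∞ fun z => ρτ t (proj z) • uτ t (proj z)
      exact ContDiff.smul (hτ.smooth_density.isSmooth_slice ht) (hτ.smooth_velocity.isSmooth_slice ht)
    have hPτi : ∀ i : Fin 3, IsContDiff 1 (fun y => (ρτ t y • uτ t y) i) := fun i =>
      (hPτ.apply i).of_le (mod_cast le_top)
    set y₀ := reprc x with hy₀
    have hxp : x = proj y₀ := by rw [hy₀, proj_reprc]
    by_cases hx : ‖reprc x‖ < 1 / 8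
    · obtain ⟨hρl, hul, hval⟩ := hcore x hx t ht
      -- time derivative
      have hdt : timeDerivWithin (Ico 0 T) ρ₁ t x = deriv (fun τ => ρE τ y₀) t :=
        timeDerivWithin_eq_deriv_of_eq (fun t' ht' => (hval t' ht').1) ht
          (differentiableAt_slice_of_contDiffOn hEρ ht.2 y₀)
      -- divergence
      have hdiv : divergence (fun y => ρ₁ t y • u₁ t y) x =
          ∑ i, fderiv ℝ (fun z => ρE t z * uE t z i) y₀ (EuclideanSpace.single i 1) := by
        simp only [divergence]
        refine Finset.sum_congr rfl fun i _ => ?_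
        rw [hxp]
        refine partialDeriv_eq_of_eventuallyEq (hPi i) ?_ i
        filter_upwards [hρl, hul] with z hz1 hz2
        simp only [lift_apply] at hz1 hz2 ⊢
        rw [PiLp.smul_apply, hz1, hz2, smul_eq_mul]
      rw [hdt, hdiv]
      exact hEmass t ht.2 y₀
    · obtain ⟨hρl, hul, hval⟩ := hext x (not_lt.1 hx) t ht
      have hdt : timeDerivWithin (Ico 0 T) ρ₁ t x = timeDerivWithin (Ico 0 T) ρτ t x :=
        timeDerivWithin_congr_slice (fun t' ht' => (hval t' ht').1) ht
      have hdiv : divergence (fun y => ρ₁ t y • u₁ t y) x = divergence (fun y => ρτ t y • uτ t y) x := by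
        simp only [divergence]
        refine Finset.sum_congr rfl fun i _ => ?_
        rw [hxp, partialDeriv_proj_eq (hPi i), partialDeriv_proj_eq (hPτi i)]
        have hev : lift (fun y => (ρ₁ t y • u₁ t y) i) =ᶠ[𝓝 y₀] lift (fun y => (ρτ t y • uτ t y) i) := by
          filter_upwards [hρl, hul] with z hz1 hz2
          simp only [lift_apply] at hz1 hz2 ⊢
          rw [PiLp.smul_apply, PiLp.smul_apply, hz1, hz2]
        rw [hev.fderiv_eq]
      rw [hdt, hdiv]
      exact hτ.mass t ht x
  · -- momentum
    set y₀ := reprc x with hy₀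
    have hxp : x = proj y₀ := by rw [hy₀, proj_reprc]
    by_cases hx : ‖reprc x‖ < 1 / 8
    · obtain ⟨hρl, hul, hval⟩ := hcore x hx t ht
      obtain ⟨hvρ, hvu⟩ := hval t ht
      have hdt : timeDerivWithin (Ico 0 T) u₁ t x = deriv (fun τ => uE τ y₀) t :=
        timeDerivWithin_eq_deriv_of_eq (fun t' ht' => (hval t' ht').2) ht
          (differentiableAt_slice_of_contDiffOn hEu ht.2 y₀)
      have hpd : ∀ i : Fin 3, partialDeriv i (u₁ t) x = fderiv ℝ (uE t) y₀ (EuclideanSpace.single i 1) :=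
        fun i => by rw [hxp]; exact partialDeriv_eq_of_eventuallyEq (hu₁1 t ht) hul i
      have hgrad : Torus.gradient (fun y => ρ₁ t y ^ (5 / 3 : ℝ) / (5 / 3)) x =
          gradient (fun z => ρE t z ^ (5 / 3 : ℝ) / (5 / 3)) y₀ := by
        rw [hxp]
        refine gradient_eq_of_eventuallyEq (hρl.mono fun z hz => ?_)
        simp only [lift_apply] at hz ⊢
        rw [hz]
      simp only [hvρ, hvu, hdt, hpd, hgrad]
      exact hEmom t ht.2 y₀
    · obtain ⟨hρl, hul, hval⟩ := hext x (not_lt.1 hx) t ht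
      obtain ⟨hvρ, hvu⟩ := hval t ht
      have hdt : timeDerivWithin (Ico 0 T) u₁ t x = timeDerivWithin (Ico 0 T) uτ t x :=
        timeDerivWithin_congr_slice (fun t' ht' => (hval t' ht').2) ht
      have hpd : ∀ i : Fin 3, partialDeriv i (u₁ t) x = partialDeriv i (uτ t) x := fun i => by
        rw [hxp, partialDeriv_proj_eq (hu₁1 t ht), partialDeriv_proj_eq (hτu1 t ht), hul.fderiv_eq]
      have hgrad : Torus.gradient (fun y => ρ₁ t y ^ (5 / 3 : ℝ) / (5 / 3)) x =
          Torus.gradient (fun y => ρτ t y ^ (5 / 3 : ℝ) / (5 / 3)) x := by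
        rw [hxp, gradient_proj_eq, gradient_proj_eq]
        refine Filter.EventuallyEq.gradient_eq (hρl.mono fun z hz => ?_)
        simp only [lift_apply] at hz ⊢
        rw [hz]
      simp only [hvρ, hvu, hdt, hpd, hgrad]
      exact hτ.momentum t ht x

end Solution

end Summit.AtomisticToContinuum.HydrodynamicLimit.Theorems

end
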